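import Summits.HodgeConjecture.HodgeConjecture.Theorems.F0P3cDyRamToricLevelCensusUnrAtThirdField  -- ★ `isUniformInducing_of_v_map_eq` (a valuation-preserving hom of `ℤᵐ⁰`-valued fields induces the uniformity; reused, not restated)
import Mathlib.RingTheory.DedekindDomain.AdicValuation
import Mathlib.RingTheory.Valuation.Integral
import Mathlib.NumberTheory.NumberField.Basic
import Mathlib.Topology.Algebra.UniformRing
import Mathlib.Topology.UniformSpace.AbstractCompletion
import HarnessLib

/-!
# R90-TF · S3, (U3-F) brick P1: A DENSE VALUATION-COMPATIBLE EMBEDDING OF A NUMBER FIELD INTO A COMPLETE NON-ARCHIMEDEAN FIELD IDENTIFIES THE COMPLETION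
# (`Theorems/R90S3CompletionOfDenseEmbedding.lean`; dealer R90-C12-plan (g2) memo `DEAL-S3-U3F-SPLIT.v1.md` §1 row P1, dealt to K2E4-p14 (g12) 2026-09-05T00:10:57Z)

Cell `hodgecm-mathlib`, crux H413 (`stmt-HodgeConjecture-24833`), route of record `HCCMUnconditional`; programme R90-TF, section S3 (base `R90-C12`), the (U3-F)
auxiliary-globalisation residual `stub_R90_S3_auxGlobaliseField` of `Cruxes/H413/Lines/R90_S3_LocalTransportWaveG.lean` (ℚ-planted road; this is brick P1 of the
planner split, «the most valuable»: it replaces any place↔factor dictionary by a DENSE EMBEDDING).  Lane `--supports stmt-HodgeConjecture-24833 --as helper`;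
THEOREMS ONLY (no definition, no instance, no `sorry`); ★∕Mathlib-only imports; ns `…R90.S3`.

THE MATHEMATICS [Serre, *Local Fields*, II §1, §3; Neukirch, *ANT*, II (4.8), (8.1)].  `L′` a number field, `K := L_w` the completion of a number field `L` at a
finite place `w` (complete, `ℤᵐ⁰`-valued, discrete), `J : L′ →+* K` a ring homomorphism with DENSE image.
* §1 `v_K ∘ J ≤ 1` on `𝓞 L′` (integrality: the valuation ring of the pulled-back valuation is integrally closed over `ℤ` — Mathlib `Valuation.Integers.mem_of_integral`),
  and by density `v_K ∘ J` hits `exp(-1)` (a neighbourhood `{z | v z = v u}` of a uniformiser `u` meets `J(L′)` — Mathlib `Valued.locally_const`).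
* §2 `w′ := {x ∈ 𝓞 L′ | v_K(J x) < 1}` is a NON-ZERO PRIME of `𝓞 L′` (`exists_heightOneSpectrum_of_denseRange`: an ideal because `v_K ∘ J ≤ 1` on `𝓞 L′`, prime by
  multiplicativity, non-zero because a numerator of an element of value `exp(-1)` lies in it).
* §3 HEART `valued_apply_eq_valuation`: `v_K(J x) = v_{w′}(x)` for every `x ∈ L′` — a `w′`-adic unit `u` is `n ∕ d` with `n, d ∉ w′` (Mathlib
  `exists_primeCompl_mul_eq_of_integer`), so `v_K(J u) = 1`; a uniformiser `π ∈ w′` of `v_{w′}` has `v_K(J π) = exp(-k)`, `k ≥ 1`, whence `v_K ∘ J = v_{w′}^k`; and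
  `k = 1` because `exp(-1)` is a value of `v_K ∘ J` (§1).
* §4 HEAD `exists_adicCompletion_ringEquiv_of_denseRange`: hence `J`, read on `WithVal v_{w′}`, PRESERVES THE VALUATION, so it induces the uniformity (★
  `isUniformInducing_of_v_map_eq`) and has dense range: `(K, J)` is an abstract completion of `(L′, v_{w′})` (Mathlib `AbstractCompletion`), and the comparison
  with the Hausdorff completion `L′_{w′} = (v_{w′}).Completion` (Mathlib `AbstractCompletion.compareEquiv`, `UniformSpace.Completion.extensionHom`, the structure
  `adicCompletion.equiv`) is a BICONTINUOUS RING ISOMORPHISM `ψ : L′_{w′} ≃+* K` with `ψ ∘ (L′ ↪ L′_{w′}) = J`.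
Consumer (memo §1 P8): with `J : L′ = ℚ(α)(√α) → L_w` the planted dense embedding, `ψ⁻¹` followed by ★ F-c `exists_localRing_equiv_of_adicCompletion_equiv` yields the
currency `Φ : LocalRing L v ≃+* LocalRing L′ v′` of `stub_R90_S3_auxGlobaliseField`.
HONEST LABEL: P1 is a sub-brick of the GENUINE residual (U3-F) and closes nothing alone; HC_CM is proved only modulo the 7 printed citations (2 remaining named
inputs: hLiu418 = stmt-HodgeConjecture-24832, h413 = stmt-HodgeConjecture-24833) until rung 0 closes; count-neutral helper.

## References
* [Serre1979] J.-P. Serre, *Local Fields*, GTM 67 (1979), Ch. II §1 (discrete valuation rings and their completions), §3.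
* [NeukirchANT1999] J. Neukirch, *Algebraic Number Theory*, Grundlehren 322 (1999), Ch. II (4.8), (8.1).
-/

set_option autoImplicit false
-- the mandated namespace repeats the single-problem summit's segment (`HodgeConjecture.HodgeConjecture`)
set_option linter.dupNamespace false

noncomputable section

open IsDedekindDomain NumberField Filter Topology WithZero
open Summit.HodgeConjecture.HodgeConjecture.Cruxes.H413.F0P3cDyRamToricLevelCensusUnrAtThirdField (isUniformInducing_of_v_map_eq)

namespace Summit.HodgeConjecture.HodgeConjecture.R90.S3

variable {L' : Type} [Field L'] [NumberField L'] {L : Type} [Field L] [NumberField L] (w : HeightOneSpectrum (𝓞 L))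
  (J : L' →+* w.adicCompletion L)

/-! ## §1 The pulled-back valuation `v_K ∘ J` on `𝓞 L′`: bounded by `1`, and `exp(-1)` is a value on `L′` -/

omit [NumberField L'] in
/-- **`v_K(J x) ≤ 1` for `x ∈ 𝓞 L′`**: `x` is integral over `ℤ`, hence over the (integrally closed) valuation ring of the pulled-back valuation `v_K ∘ J`
(Mathlib `Valuation.Integers.mem_of_integral`). [cite: NeukirchANT1999, Ch. II (4.8)] -/
theorem valued_apply_le_one_of_mem_ringOfIntegers (x : 𝓞 L') : Valued.v (J (x : L')) ≤ 1 := by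
  let v' : Valuation L' ℤᵐ⁰ := Valued.v.comap J
  have hint : IsIntegral v'.integer (x : L') := (RingOfIntegers.isIntegral_coe x).tower_top
  have hmem : (x : L') ∈ v'.integer := (Valuation.integer.integers v').mem_of_integral hint
  exact hmem

omit [NumberField L'] in
/-- **By density `v_K ∘ J` takes the value `exp(-1)`** (the set `{z | v_K z = v_K u}`, `u` a uniformiser of `K`, is a neighbourhood of `u` — Mathlib
`Valued.locally_const` — and meets the dense image of `J`). [cite: Serre1979, Ch. II §1] -/
theorem exists_valued_apply_eq_exp_neg_one (hJ : DenseRange J) : ∃ y : L', Valued.v (J y) = exp (-1 : ℤ) := by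
  obtain ⟨u, hu⟩ := HeightOneSpectrum.valuedAdicCompletion_surjective L w (exp (-1 : ℤ))
  have hu0 : (Valued.v u : ℤᵐ⁰) ≠ 0 := by rw [hu]; exact exp_ne_zero
  obtain ⟨y, hy⟩ := hJ.mem_nhds (Valued.locally_const hu0)
  exact ⟨y, by rw [Set.mem_setOf_eq] at hy; rw [hy, hu]⟩

/-! ## §2 The prime `w′ = {x ∈ 𝓞 L′ | v_K(J x) < 1}` -/

/-- **The centre of `v_K ∘ J` on `𝓞 L′` is a non-zero prime**: there is `w′ : HeightOneSpectrum (𝓞 L′)` with `x ∈ w′ ⟺ v_K(J x) < 1` (an ideal since `v_K ∘ J ≤ 1`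
on `𝓞 L′`; prime by multiplicativity; non-zero: a numerator of an element of `L′` of value `exp(-1)` lies in it). [cite: NeukirchANT1999, Ch. II (8.1)] -/
theorem exists_heightOneSpectrum_of_denseRange (hJ : DenseRange J) :
    ∃ w' : HeightOneSpectrum (𝓞 L'), ∀ x : 𝓞 L', x ∈ w'.asIdeal ↔ Valued.v (J (x : L')) < 1 := by
  have hle := valued_apply_le_one_of_mem_ringOfIntegers w J
  let P : Ideal (𝓞 L') :=
    { carrier := {x | Valued.v (J (x : L')) < 1}
      add_mem' := fun {a b} ha hb => by
        simp only [Set.mem_setOf_eq, RingOfIntegers.coe_eq_algebraMap, map_add] at ha hb ⊢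
        exact lt_of_le_of_lt (Valuation.map_add _ _ _) (max_lt ha hb)
      zero_mem' := by simp
      smul_mem' := fun c x hx => by
        simp only [Set.mem_setOf_eq, smul_eq_mul, RingOfIntegers.coe_eq_algebraMap, map_mul] at hx ⊢
        have hc : Valued.v (J (algebraMap (𝓞 L') L' c)) ≤ 1 := by simpa [RingOfIntegers.coe_eq_algebraMap] using hle c
        exact (mul_le_mul_left hc _).trans_lt (by rwa [one_mul]) }
  have hmem : ∀ x : 𝓞 L', x ∈ P ↔ Valued.v (J (x : L')) < 1 := fun x => Iff.rfl
  have hprime : P.IsPrime := by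
    refine ⟨fun htop => ?_, fun {a b} hab => ?_⟩
    · have h1 : (1 : 𝓞 L') ∈ P := htop ▸ Submodule.mem_top
      rw [hmem] at h1
      simp at h1
    · rw [hmem] at hab ⊢
      rw [hmem]
      by_contra h
      push Not at h
      obtain ⟨ha, hb⟩ := h
      have ha' : Valued.v (J (a : L')) = 1 := le_antisymm (hle a) ha
      have hb' : Valued.v (J (b : L')) = 1 := le_antisymm (hle b) hb
      rw [RingOfIntegers.coe_eq_algebraMap, map_mul, map_mul, map_mul, ← RingOfIntegers.coe_eq_algebraMap, ← RingOfIntegers.coe_eq_algebraMap,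
        ha', hb', mul_one] at hab
      exact lt_irrefl _ hab
  have hbot : P ≠ ⊥ := by
    obtain ⟨y, hy⟩ := exists_valued_apply_eq_exp_neg_one w J hJ
    obtain ⟨a, b, hb, rfl⟩ := IsFractionRing.div_surjective (A := 𝓞 L') y
    have hb0 : (algebraMap (𝓞 L') L' b) ≠ 0 := IsFractionRing.to_map_ne_zero_of_mem_nonZeroDivisors hb
    have ha0 : a ≠ 0 := by
      rintro rfl
      simp only [map_zero, zero_div] at hy
      exact exp_ne_zero hy.symm
    intro hP
    have haP : a ∈ P := by
      rw [hmem, RingOfIntegers.coe_eq_algebraMap]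
      have hy1 : Valued.v (J (algebraMap (𝓞 L') L' a / algebraMap (𝓞 L') L' b)) < 1 := by
        rw [hy, ← exp_zero, exp_lt_exp]; omega
      rw [map_div₀, map_div₀, div_lt_one₀ ((Valuation.pos_iff _).2 ((map_ne_zero J).2 hb0))] at hy1
      exact lt_of_lt_of_le hy1 (by simpa [RingOfIntegers.coe_eq_algebraMap] using hle b)
    rw [hP] at haP
    exact ha0 ((Submodule.mem_bot (𝓞 L')).1 haP)
  exact ⟨⟨P, hprime, hbot⟩, hmem⟩

/-! ## §3 HEART: `v_K ∘ J` IS the `w′`-adic valuation -/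

omit [NumberField L'] in
/-- On `𝓞 L′`: `v_K(J n) = 1 ⟺ n ∉ w′`. [cite: NeukirchANT1999, Ch. II (8.1)] -/
theorem valued_apply_eq_one_iff_not_mem {w' : HeightOneSpectrum (𝓞 L')} (hw' : ∀ x : 𝓞 L', x ∈ w'.asIdeal ↔ Valued.v (J (x : L')) < 1)
    (n : 𝓞 L') : Valued.v (J (n : L')) = 1 ↔ n ∉ w'.asIdeal := by
  rw [hw' n, not_lt]
  exact ⟨fun h => h.ge, fun h => le_antisymm (valued_apply_le_one_of_mem_ringOfIntegers w J n) h⟩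

/-- **A `w′`-adic unit has `v_K(J u) = 1`**: `u = n ∕ d` with `n, d ∉ w′` (Mathlib `exists_primeCompl_mul_eq_of_integer`). [cite: Serre1979, Ch. II §1] -/
theorem valued_apply_eq_one_of_valuation_eq_one {w' : HeightOneSpectrum (𝓞 L')} (hw' : ∀ x : 𝓞 L', x ∈ w'.asIdeal ↔ Valued.v (J (x : L')) < 1)
    {u : L'} (hu : w'.valuation L' u = 1) : Valued.v (J u) = 1 := by
  obtain ⟨n, d, hnd⟩ := HeightOneSpectrum.exists_primeCompl_mul_eq_of_integer w' u hu.le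
  have hd1 : Valued.v (J (algebraMap (𝓞 L') L' d)) = 1 := by
    rw [← RingOfIntegers.coe_eq_algebraMap, valued_apply_eq_one_iff_not_mem w J hw']
    exact d.2
  have hdv : w'.valuation L' (algebraMap (𝓞 L') L' d) = 1 := by
    rw [HeightOneSpectrum.valuation_of_algebraMap, HeightOneSpectrum.intValuation_eq_one_iff]
    exact d.2
  have hnv : w'.valuation L' (algebraMap (𝓞 L') L' n) = 1 := by rw [← hnd, map_mul, hu, hdv, one_mul]
  have hnP : n ∉ w'.asIdeal := by
    rw [← HeightOneSpectrum.intValuation_eq_one_iff, ← HeightOneSpectrum.valuation_of_algebraMap (K := L')]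
    exact hnv
  have hn1 : Valued.v (J (algebraMap (𝓞 L') L' n)) = 1 := by
    rw [← RingOfIntegers.coe_eq_algebraMap, valued_apply_eq_one_iff_not_mem w J hw']
    exact hnP
  have h := congrArg (fun z => Valued.v (J z)) hnd
  simp only [map_mul, hd1, hn1, mul_one] at h
  exact h

/-- **HEART — `v_K(J x) = v_{w′}(x)` for all `x ∈ L′`** (units by the previous lemma; a uniformiser `π` of `w′` has `v_K(J π) = exp(-k)` with `k ≥ 1`, so `v_K ∘ J = v_{w′}^k`,
and `k = 1` because `exp(-1)` is attained by density). [cite: Serre1979, Ch. II §1] [cite: NeukirchANT1999, Ch. II (4.8)] -/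
theorem valued_apply_eq_valuation (hJ : DenseRange J) {w' : HeightOneSpectrum (𝓞 L')}
    (hw' : ∀ x : 𝓞 L', x ∈ w'.asIdeal ↔ Valued.v (J (x : L')) < 1) (x : L') :
    Valued.v (J x) = w'.valuation L' x := by
  -- a uniformiser `π ∈ 𝓞 L′` of `w′`, and the value `a := v_K (J π) = exp (log a)`, `log a ≤ -1`
  obtain ⟨π, hπ⟩ := HeightOneSpectrum.valuation_exists_uniformizer' L' w'
  have hπa : w'.valuation L' (algebraMap (𝓞 L') L' π) = exp (-1 : ℤ) := hπ
  have hπP : π ∈ w'.asIdeal := by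
    rw [← HeightOneSpectrum.valuation_lt_one_iff_mem (K := L'), hπ, ← exp_zero, exp_lt_exp]; omega
  have hπ0 : (algebraMap (𝓞 L') L' π) ≠ 0 := by
    intro h
    rw [h, map_zero] at hπa
    exact exp_ne_zero hπa.symm
  set a : ℤᵐ⁰ := Valued.v (J (algebraMap (𝓞 L') L' π)) with ha_def
  have ha0 : a ≠ 0 := (Valuation.ne_zero_iff _).2 ((map_ne_zero J).2 hπ0)
  have ha1 : a < 1 := by rw [ha_def, ← RingOfIntegers.coe_eq_algebraMap]; exact (hw' π).1 hπP
  have hla : log a ≤ -1 := by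
    have h : a < exp 0 := by rwa [exp_zero]
    rw [← exp_log ha0, exp_lt_exp] at h
    omega
  -- KEY: `v_K (J x) = a ^ (-(log v_{w′} x))` for `x ≠ 0`
  have key : ∀ {x : L'}, x ≠ 0 → Valued.v (J x) = a ^ (-(log (w'.valuation L' x))) := by
    intro x hx
    have hvx : w'.valuation L' x ≠ 0 := (Valuation.ne_zero_iff _).2 hx
    set m : ℤ := log (w'.valuation L' x) with hm
    have hxm : w'.valuation L' x = exp m := (exp_log hvx).symm
    have hu : w'.valuation L' (x * (algebraMap (𝓞 L') L' π) ^ m) = 1 := by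
      rw [map_mul, map_zpow₀, hπa, hxm, ← exp_zsmul, ← exp_add, ← exp_zero]
      congr 1
      simp
    have h1 := valued_apply_eq_one_of_valuation_eq_one w J hw' hu
    rw [map_mul, map_zpow₀, map_mul, map_zpow₀, ← ha_def] at h1
    rw [eq_inv_of_mul_eq_one_left h1, ← zpow_neg]
  -- `log a = -1` from the attained value `exp (-1)`
  have hloga : log a = -1 := by
    obtain ⟨y, hy⟩ := exists_valued_apply_eq_exp_neg_one w J hJ
    have hy0 : y ≠ 0 := by
      rintro rfl
      rw [map_zero, map_zero] at hy
      exact exp_ne_zero hy.symm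
    rw [key hy0, ← exp_log ha0, ← exp_zsmul, exp_inj, smul_eq_mul] at hy
    -- hy : -(log v x) * log a = -1
    have hprod : log (w'.valuation L' y) * log a = 1 := by linarith
    rcases Int.eq_one_or_neg_one_of_mul_eq_one' hprod with ⟨_, h⟩ | ⟨_, h⟩
    · omega
    · exact h
  -- conclude
  rcases eq_or_ne x 0 with rfl | hx
  · simp only [map_zero]
  · have hvx : w'.valuation L' x ≠ 0 := (Valuation.ne_zero_iff _).2 hx
    rw [key hx, ← exp_log ha0, hloga, ← exp_zsmul]
    conv_rhs => rw [← exp_log hvx]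
    congr 1
    simp

/-! ## §4 HEAD: the completion at `w′` is `K`, by a bicontinuous ring isomorphism extending `J` -/

/-- **P1 — A DENSE VALUATION-COMPATIBLE EMBEDDING OF A NUMBER FIELD INTO A COMPLETE NON-ARCHIMEDEAN FIELD IDENTIFIES THE COMPLETION.**  For a number field `L′`,
the completion `K = L_w` of a number field at a finite place, and a ring homomorphism `J : L′ →+* K` with dense image: there is a finite place `w′` of `L′`, namely
`w′ = {x ∈ 𝓞 L′ | v_K(J x) < 1}`, and a ring isomorphism `ψ : L′_{w′} ≃+* K`, continuous with continuous inverse, with `ψ(x) = J(x)` for `x ∈ L′`.  Proof: §3 makes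
`J` valuation-preserving on `WithVal v_{w′}`, hence uniformity-inducing (★ `isUniformInducing_of_v_map_eq`); `(K, J)` is then an abstract completion of `(L′, v_{w′})`
and `ψ` is the comparison with the Hausdorff completion (Mathlib `AbstractCompletion.compareEquiv` ∕ `UniformSpace.Completion.extensionHom` ∕ `adicCompletion.equiv`).
[cite: Serre1979, Ch. II §1, §3] [cite: NeukirchANT1999, Ch. II (4.8)] -/
theorem exists_adicCompletion_ringEquiv_of_denseRange (hJ : DenseRange J) :
    ∃ w' : HeightOneSpectrum (𝓞 L'), (∀ x : 𝓞 L', x ∈ w'.asIdeal ↔ Valued.v (J (x : L')) < 1) ∧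
      ∃ ψ : w'.adicCompletion L' ≃+* w.adicCompletion L, Continuous ψ ∧ Continuous ψ.symm ∧ ∀ x : L', ψ (x : w'.adicCompletion L') = J x := by
  obtain ⟨w', hw'⟩ := exists_heightOneSpectrum_of_denseRange w J hJ
  refine ⟨w', hw', ?_⟩
  have hval := valued_apply_eq_valuation w J hJ hw'
  -- `J` read on `WithVal v_{w′}` preserves the valuation
  let J' : WithVal (w'.valuation L') →+* w.adicCompletion L := J.comp (WithVal.equiv (w'.valuation L')).toRingHom
  have hJ'apply : ∀ x, J' x = J (WithVal.equiv (w'.valuation L') x) := fun x => rfl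
  have hjv : ∀ x : WithVal (w'.valuation L'), Valued.v (J' x) = Valued.v x := fun x => by
    rw [hJ'apply, hval, WithVal.val_apply_equiv]
  -- a uniformiser of the source
  obtain ⟨π, hπ⟩ := HeightOneSpectrum.valuation_exists_uniformizer L' w'
  have hπ' : Valued.v ((WithVal.equiv (w'.valuation L')).symm π) = exp (-1 : ℤ) := by
    rw [← WithVal.val_apply_equiv, RingEquiv.apply_symm_apply, hπ]
  have hUI : IsUniformInducing J' := isUniformInducing_of_v_map_eq J' hjv hπ'
  have hcont : Continuous J' := hUI.uniformContinuous.continuous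
  have hdense : DenseRange J' := by
    have hr : Set.range J' = Set.range J := by
      ext z
      constructor
      · rintro ⟨x, rfl⟩
        exact ⟨_, (hJ'apply x).symm⟩
      · rintro ⟨x, rfl⟩
        exact ⟨(WithVal.equiv (w'.valuation L')).symm x, by rw [hJ'apply, RingEquiv.apply_symm_apply]⟩
    change Dense (Set.range J')
    rw [hr]
    exact hJ
  -- `(K, J′)` is an abstract completion of `WithVal v_{w′}`; compare with the Hausdorff completion
  let pkg : AbstractCompletion (WithVal (w'.valuation L')) :=
    { space := w.adicCompletion L
      coe := J'
      uniformStruct := inferInstance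
      complete := inferInstance
      separation := inferInstance
      isUniformInducing := hUI
      dense := hdense }
  let e : (w'.valuation L').Completion ≃ᵤ w.adicCompletion L := (UniformSpace.Completion.cPkg (α := WithVal (w'.valuation L'))).compareEquiv pkg
  let ψ₀ : (w'.valuation L').Completion →+* w.adicCompletion L := UniformSpace.Completion.extensionHom J' hcont
  have hψ₀e : ∀ z, ψ₀ z = e z := fun z => rfl
  have hbij : Function.Bijective ψ₀ := by
    rw [show (ψ₀ : (w'.valuation L').Completion → w.adicCompletion L) = e from funext hψ₀e]
    exact e.bijective
  let ψ₁ : (w'.valuation L').Completion ≃+* w.adicCompletion L := RingEquiv.ofBijective ψ₀ hbij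
  have hψ₁symm : ∀ z, ψ₁.symm z = e.symm z := fun z => by
    rw [RingEquiv.symm_apply_eq, RingEquiv.ofBijective_apply, hψ₀e, UniformEquiv.apply_symm_apply]
  let ψ : w'.adicCompletion L' ≃+* w.adicCompletion L := (HeightOneSpectrum.adicCompletion.equiv L' w').trans ψ₁
  refine ⟨ψ, ?_, ?_, fun x => ?_⟩
  · exact e.continuous.comp (HeightOneSpectrum.adicCompletion.continuous_toCompletion L' w')
  · have h : ∀ z, ψ.symm z = HeightOneSpectrum.adicCompletion.ofCompletion (e.symm z) := fun z => by
      change (HeightOneSpectrum.adicCompletion.equiv L' w').symm (ψ₁.symm z) = _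
      rw [hψ₁symm]
      rfl
    exact ((HeightOneSpectrum.adicCompletion.continuous_ofCompletion L' w').comp e.symm.continuous).congr fun z => (h z).symm
  · change ψ₀ (((WithVal.equiv (w'.valuation L')).symm x : WithVal (w'.valuation L')) : (w'.valuation L').Completion) = J x
    rw [UniformSpace.Completion.extensionHom_coe, hJ'apply, RingEquiv.apply_symm_apply]

end Summit.HodgeConjecture.HodgeConjecture.R90.S3

end
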